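import Mathlib
import Summits.ValiantsHypothesis.ValiantsHypothesis.Theorems.BorderApolarityToricWitnessObstructionQPInitialDegeneration

/-!
# Component calculus: homogeneous / weighted components versus partial derivatives and cones

Route `ValiantsHypothesis/BorderApolarity`, crux `ToricWitnessObstructionQP`
(stmt-ValiantsHypothesis-14753), line `Sketch`, lead c5 — fourth helper for the regime analysis of
torus leading forms of `per₃` below Grenet's size `7` (crux work note `regimes.md`, §3): the small
identities that move the jet-regime theorem between `P = det(A₀ + B(y))`, its cubic part `P₃`,
its torus leading form `in_w P₃ = per₃`, and their partial derivatives.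

* `homogeneousComponent_pderiv`: `(∂_a f)_k = ∂_a (f_{k+1})`;
* `weightedHomogeneousComponent_pderiv`: `in^w_{e} (∂_a f) = ∂_a (in^w_{e + w a} f)`;
* `constantCoeff_pderiv_eq_coeff`, `coeff_single_pderiv`: the constant terms of the first and
  second partials are degree-`1` and degree-`2` coefficients, hence vanish when the components
  `f₁`, `f₂` vanish (`constantCoeff_pderiv_eq_zero_of_component_one`,
  `constantCoeff_pderiv_pderiv_eq_zero_of_component_two`);
* `eval_homogeneousComponent_eq_zero_of_subspace`: a polynomial vanishing on a linear subspace
  (infinite field) has all its homogeneous components vanishing there (the subspace is a cone).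
-/

open MvPolynomial Module
open scoped Polynomial

-- the mandated summit-side namespace repeats a component by design (single-problem summit)
set_option linter.dupNamespace false

namespace Summit.ValiantsHypothesis.ValiantsHypothesis.Theorems.BorderApolarityToricWitnessObstructionQP

noncomputable section

namespace ComponentCalculus

variable {K : Type*} [Field K] {σ : Type*}

/-- `(s - e_a) + e_a = s` when `s a ≠ 0`: this is Mathlib's `Finsupp.sub_add_single_one_cancel`
(deprecated duplicate kept as an alias, dedup-03033). [folklore] -/
@[deprecated Finsupp.sub_add_single_one_cancel (since := "2026-08-17")]
alias tsub_single_add_single := Finsupp.sub_add_single_one_cancel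

/-- `(∂_a f)_k = ∂_a (f_{k+1})`: taking a partial derivative lowers the degree by one. [folklore] -/
theorem homogeneousComponent_pderiv [DecidableEq σ] (a : σ) (f : MvPolynomial σ K) (k : ℕ) :
    homogeneousComponent k (pderiv a f) = pderiv a (homogeneousComponent (k + 1) f) := by
  classical
  induction f using MvPolynomial.induction_on' with
  | monomial s c =>
    rw [pderiv_monomial, homogeneousComponent_of_mem (isHomogeneous_monomial _ rfl),
      homogeneousComponent_of_mem (isHomogeneous_monomial _ rfl)]
    by_cases hs : s a = 0
    · split_ifs <;> simp [pderiv_monomial, hs]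
    · have hdeg : (s - Finsupp.single a 1).degree + 1 = s.degree := by
        conv_rhs => rw [← Finsupp.sub_add_single_one_cancel hs]
        rw [map_add, Finsupp.degree_single]
      split_ifs with h1 h2 h2
      · rw [pderiv_monomial]
      · exfalso; omega
      · exfalso; omega
      · rw [map_zero]
  | add p q hp hq => rw [map_add, map_add, hp, hq, map_add, map_add]

/-- `weight w e_a = w a`. -/
theorem weight_single_one (w : σ → ℕ) (a : σ) : Finsupp.weight w (Finsupp.single a 1) = w a := by
  rw [Finsupp.weight_apply, Finsupp.sum_single_index (by simp)]
  simp

/-- `in^w_e (∂_a f) = ∂_a (in^w_{e + w a} f)`: a partial derivative lowers the `w`-weight by `w a`.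
[folklore] -/
theorem weightedHomogeneousComponent_pderiv [DecidableEq σ] (w : σ → ℕ) (a : σ)
    (f : MvPolynomial σ K) (e : ℕ) :
    weightedHomogeneousComponent w e (pderiv a f) =
      pderiv a (weightedHomogeneousComponent w (e + w a) f) := by
  classical
  induction f using MvPolynomial.induction_on' with
  | monomial s c =>
    rw [pderiv_monomial,
      weightedHomogeneousComponent_of_mem (isWeightedHomogeneous_monomial w _ _ rfl),
      weightedHomogeneousComponent_of_mem (isWeightedHomogeneous_monomial w _ _ rfl)]
    by_cases hs : s a = 0
    · split_ifs <;> simp [pderiv_monomial, hs]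
    · have hdeg : Finsupp.weight w (s - Finsupp.single a 1) + w a = Finsupp.weight w s := by
        conv_rhs => rw [← Finsupp.sub_add_single_one_cancel hs]
        rw [map_add, weight_single_one]
      split_ifs with h1 h2 h2
      · rw [pderiv_monomial]
      · exfalso; omega
      · exfalso; omega
      · rw [map_zero]
  | add p q hp hq => rw [map_add, map_add, hp, hq, map_add, map_add]

/-- The constant term of `∂_a f` is the coefficient of `x_a`. [folklore] -/
theorem constantCoeff_pderiv_eq_coeff [DecidableEq σ] (a : σ) (f : MvPolynomial σ K) :
    constantCoeff (pderiv a f) = coeff (Finsupp.single a 1) f := by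
  classical
  induction f using MvPolynomial.induction_on' with
  | monomial s c =>
    rw [pderiv_monomial, constantCoeff_monomial, coeff_monomial]
    by_cases hsa : s a = 0
    · rw [hsa, Nat.cast_zero, mul_zero, ite_self, if_neg]
      intro h
      have := congr_arg (fun t : σ →₀ ℕ => t a) h
      simp only [Finsupp.single_apply, if_true] at this
      omega
    · by_cases hs : s = Finsupp.single a 1
      · subst hs
        simp
      · rw [if_neg hs, if_neg]
        intro h0
        apply hs
        ext b
        have hb := congr_arg (fun t : σ →₀ ℕ => t b) h0
        simp only [Finsupp.coe_tsub, Pi.sub_apply, Finsupp.single_apply, Finsupp.coe_zero,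
          Pi.zero_apply] at hb ⊢
        split_ifs at hb ⊢ with h
        · subst h; omega
        · omega
  | add p q hp hq => rw [map_add, map_add, hp, hq, coeff_add]

/-- If the linear part `f₁` vanishes then `∂_a f` has no constant term. [folklore] -/
theorem constantCoeff_pderiv_eq_zero_of_component_one [DecidableEq σ] (a : σ) (f : MvPolynomial σ K)
    (h1 : homogeneousComponent 1 f = 0) : constantCoeff (pderiv a f) = 0 := by
  classical
  rw [constantCoeff_pderiv_eq_coeff]
  have h := congr_arg (coeff (Finsupp.single a 1)) h1
  rwa [coeff_homogeneousComponent, if_pos (by simp), coeff_zero] at h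

/-- The coefficient of `x_b` in `∂_a f` is `(s a)`-times the coefficient of `x_a x_b` in `f`
(`s = e_a + e_b`). [folklore] -/
theorem coeff_single_pderiv [DecidableEq σ] (a b : σ) (f : MvPolynomial σ K) :
    coeff (Finsupp.single b 1) (pderiv a f) =
      ((Finsupp.single a 1 + Finsupp.single b 1 : σ →₀ ℕ) a : K) *
        coeff (Finsupp.single a 1 + Finsupp.single b 1) f := by
  classical
  induction f using MvPolynomial.induction_on' with
  | monomial s c =>
    rw [pderiv_monomial, coeff_monomial, coeff_monomial]
    by_cases hse : s = Finsupp.single a 1 + Finsupp.single b 1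
    · subst hse
      have hsub : Finsupp.single a 1 + Finsupp.single b 1 - Finsupp.single a 1 =
          (Finsupp.single b 1 : σ →₀ ℕ) := by
        ext x
        simp only [Finsupp.coe_tsub, Finsupp.coe_add, Pi.sub_apply, Pi.add_apply,
          Finsupp.single_apply]
        split_ifs <;> omega
      rw [if_pos hsub, if_pos rfl, mul_comm]
    · rw [if_neg hse, mul_zero]
      by_cases hsa : s a = 0
      · rw [hsa, Nat.cast_zero, mul_zero, ite_self]
      · rw [if_neg]
        intro h
        apply hse
        ext x
        have hx := congr_arg (fun t : σ →₀ ℕ => t x) h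
        simp only [Finsupp.coe_tsub, Finsupp.coe_add, Pi.sub_apply, Pi.add_apply,
          Finsupp.single_apply] at hx ⊢
        by_cases hxa : a = x
        · subst hxa
          simp only [if_true] at hx ⊢
          split_ifs at hx ⊢ <;> omega
        · rw [if_neg hxa] at hx ⊢
          split_ifs at hx ⊢ <;> omega
  | add p q hp hq => rw [map_add, coeff_add, coeff_add, hp, hq, mul_add]

/-- If the quadratic part `f₂` vanishes then `∂_b ∂_a f` has no constant term. [folklore] -/
theorem constantCoeff_pderiv_pderiv_eq_zero_of_component_two [DecidableEq σ] (a b : σ)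
    (f : MvPolynomial σ K) (h2 : homogeneousComponent 2 f = 0) :
    constantCoeff (pderiv b (pderiv a f)) = 0 := by
  classical
  rw [constantCoeff_pderiv_eq_coeff, coeff_single_pderiv]
  have h := congr_arg (coeff (Finsupp.single a 1 + Finsupp.single b 1)) h2
  rw [coeff_homogeneousComponent, coeff_zero, if_pos] at h
  · rw [h, mul_zero]
  · rw [map_add, Finsupp.degree_single, Finsupp.degree_single]

/-- Evaluating along constants embedded in `K[T]`: `g(C ∘ x) = C (g(x))`. [folklore] -/
theorem aeval_C_comp (x : σ → K) (q : MvPolynomial σ K) :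
    aeval (fun a => Polynomial.C (x a)) q = Polynomial.C (MvPolynomial.eval x q) := by
  induction q using MvPolynomial.induction_on with
  | C r => simp
  | add p q hp hq => rw [map_add, map_add, map_add, hp, hq]
  | mul_X p n hp => rw [map_mul, map_mul, map_mul, hp, aeval_X, eval_X]

/-- **A polynomial vanishing on a linear subspace has all its homogeneous components vanishing
there** (the subspace is a cone; infinite field). [folklore] -/
theorem eval_homogeneousComponent_eq_zero_of_subspace [Fintype σ] [Infinite K]
    (W : Submodule K (σ → K)) (g : MvPolynomial σ K) (hg : ∀ x ∈ W, MvPolynomial.eval x g = 0)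
    (k : ℕ) : ∀ x ∈ W, MvPolynomial.eval x (homogeneousComponent k g) = 0 := by
  classical
  intro x hx
  -- the curve `T • x` lies in `W`, so `g(T x) = Σ_j C(g_j(x)) T^j = 0` formally
  have hformal := InitialDegeneration.aeval_eq_zero_of_forall_mem W g hg {0}
    (fun _ => (Polynomial.X : K[X])) (fun _ => x) (fun _ _ => hx)
  simp only [Finset.sum_singleton] at hformal
  have hexp : aeval (fun a => Polynomial.C (x a) * (Polynomial.X : K[X])) g =
      ∑ j ∈ Finset.range (g.totalDegree + 1),
        Polynomial.C (MvPolynomial.eval x (homogeneousComponent j g)) * (Polynomial.X : K[X]) ^ j := by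
    conv_lhs => rw [← sum_homogeneousComponent g]
    rw [map_sum]
    refine Finset.sum_congr rfl fun j _ => ?_
    have hh : IsWeightedHomogeneous (1 : σ → ℕ) (homogeneousComponent j g) j :=
      homogeneousComponent_isHomogeneous j g
    have h := InitialDegeneration.aeval_pow_mul_of_isWeightedHomogeneous (1 : σ → ℕ) hh
      (Polynomial.X : K[X]) (fun a => Polynomial.C (x a))
    simp only [Pi.one_apply, pow_one] at h
    have hfun : (fun a => Polynomial.C (x a) * (Polynomial.X : K[X])) =
        fun v => (Polynomial.X : K[X]) * Polynomial.C (x v) := funext fun a => mul_comm _ _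
    rw [hfun, h, aeval_C_comp, mul_comm]
  rw [hexp] at hformal
  have hcoeff := congr_arg (fun q : K[X] => q.coeff k) hformal
  simp only [Polynomial.finsetSum_coeff, Polynomial.coeff_C_mul_X_pow, Polynomial.coeff_zero]
    at hcoeff
  rw [Finset.sum_ite_eq] at hcoeff
  by_cases hk : k ≤ g.totalDegree
  · rwa [if_pos (Finset.mem_range.2 (Nat.lt_succ_of_le hk))] at hcoeff
  · rw [homogeneousComponent_eq_zero _ _ (by omega), map_zero]

end ComponentCalculus

/-- **Cone components** (registered helper form of
`ComponentCalculus.eval_homogeneousComponent_eq_zero_of_subspace`): a polynomial vanishing on a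
linear subspace of `K^σ` (`K` infinite) has every homogeneous component vanishing there.
[folklore] -/
theorem coneComponents_of_vanishing : ∀ {K : Type*} [Field K] {σ : Type*} [Fintype σ] [Infinite K] (W : Submodule K (σ → K)) (g : MvPolynomial σ K), (∀ x ∈ W, MvPolynomial.eval x g = 0) → ∀ (k : ℕ), ∀ x ∈ W, MvPolynomial.eval x (MvPolynomial.homogeneousComponent k g) = 0 :=
  fun W g hg k => ComponentCalculus.eval_homogeneousComponent_eq_zero_of_subspace W g hg k

end

end Summit.ValiantsHypothesis.ValiantsHypothesis.Theorems.BorderApolarityToricWitnessObstructionQP
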